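import Literature.Computability.Complexity.OneInThreeSubsetSum
import Literature.Computability.Complexity.XRayMachineIdx
import Literature.Computability.Complexity.KnapsackPartition
import Literature.Computability.Complexity.SumProdFolds
import HarnessLib

/-!
# `ONE-IN-THREE 3SAT ≤ₚ KNAPSACK`: the machine half, and the NP-completeness of KNAPSACK and PARTITION

Karp 1972, Main Theorem, problems 18 (KNAPSACK, `∑ aⱼxⱼ = b`, i.e. SUBSET SUM) and 20 (PARTITION);
Sipser, Thm. 7.56 (`3SAT ≤ₚ SUBSET-SUM`). `OneInThreeSubsetSum.lean` proves the arithmetic of the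
occurrence-indexed transformation from ONE-IN-THREE 3SAT (`OneInThreeSS.numbers φ`, `target φ`,
correctness `OneInThreeSS.exists_sel_iff`); this file computes `(numbers φ, target φ)` on CNF codes in
polynomial time (brick algebra over the `FP` toolkit, no machine written by hand) and assembles:

* `OneInThreeSS.knapsack_iff` — `(numbers φ, target φ) ∈ knapsackSet ↔ φ` one-in-three satisfiable
  (sublists ↔ masks ↔ selections, on top of `exists_sel_iff`);
* the pieces: literal accessors by occurrence index `a = 3i + j` (`divModFn`, `Ladder3.aF`,
  `nthItemFn`), the power `⌜4ᵉ⌝` of a unary exponent, the digit terms `[var a = var b]·4^{pos a b}`,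
  the numbers `numT a`, `numF a` (sum folds `Brick.foldSum`), the list `numbers φ` (`Brick.foldCat`)
  and `target φ`; the guard is `OneInThree.goodF` (canonical code with three distinct literals per clause);
* **`ONEIN3SAT_karpReducible_KNAPSACK : ONEIN3SAT ≤ₚ KNAPSACK`**, hence `KNAPSACK_isNPHard`
  (`Schaefer1978_oneInThreeSAT_NPHard_holds`), **`isNPComplete_KNAPSACK_holds`** (with
  `Knapsack.KNAPSACK_mem_NP`) and **`isNPComplete_PARTITION_holds`** (Karp's `KNAPSACK ∝ PARTITION`,
  `Knapsack.KNAPSACK_karpReducible_PARTITION`, `Knapsack.PARTITION_mem_NP`) — the discharges of the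
  named facts of `KarpProblems.lean`.

## References

* [Karp1972] R. M. Karp, *Reducibility among combinatorial problems* (1972), §4, Main Theorem,
  problems 18 and 20.
* [Sipser2012] M. Sipser, *Introduction to the Theory of Computation*, 3rd ed., Thm. 7.56.
* [GareyJohnson1979] M. R. Garey, D. S. Johnson, *Computers and Intractability* (1979), [LO4], §3.1.5.
* [AroraBarak2009] S. Arora, B. Barak, *Computational Complexity*, CUP 2009, §1.3 (polynomial time is
  closed under composition and bounded loops), §0.1 (codes of lists), Def. 2.7.
-/

noncomputable section

namespace Literature.Computability.Complexity

open scoped Notation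

namespace OneInThreeSS

open _root_.Computability Polynomial Brick HashBricks Plumb Knapsack OneInThree Finset

/-! ### The bridge to `knapsackSet` -/

/-- A masked sum along `(range n).map f` is a selection sum. [folklore] -/
theorem maskSum_map_range (f : ℕ → ℕ) : ∀ (n i₀ : ℕ) (μ : List Bool),
    maskSum μ ((List.range' i₀ n).map f) = ∑ k ∈ range n, if μ.getD k false then f (i₀ + k) else 0
  | 0, i₀, μ => by simp
  | n + 1, i₀, μ => by
    rw [List.range'_succ, List.map_cons, sum_range_succ']
    cases μ with
    | nil => simp
    | cons b μ =>
      rw [maskSum_cons_cons, maskSum_map_range f n (i₀ + 1) μ, add_comm]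
      simp only [List.getD_cons_succ, List.getD_cons_zero, Nat.add_zero]
      congr 1
      · exact sum_congr rfl fun k _ => by rw [show i₀ + 1 + k = i₀ + (k + 1) by ring]
      · cases b <;> simp

/-- **`(numbers φ, target φ) ∈ knapsackSet` iff `φ` is one-in-three satisfiable** (for three
literals per clause): sublists are masks (`Knapsack.exists_mask_of_sublist` /
`exists_sublist_of_mask`), masks are selections by index, and `exists_sel_iff`.
[cite: Sipser2012, Thm 7.56] [cite: Karp1972, §4 (problem 18)] -/
theorem knapsack_iff (φ : CNF ℕ) (h3 : ∀ c ∈ φ, c.length = 3) :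
    (numbers φ, target φ) ∈ knapsackSet ↔ φ.XSatisfiable := by
  rw [← exists_sel_iff h3]
  constructor
  · rintro ⟨l', hl', hs⟩
    obtain ⟨μ, -, hsum⟩ := exists_mask_of_sublist hl'
    refine ⟨fun k => μ.getD k false, ?_⟩
    simp only at hs
    rw [← hs, ← hsum, numbers, List.range_eq_range', maskSum_map_range]
    simp [selSum]
  · rintro ⟨S, hS⟩
    obtain ⟨l', hl', hsum⟩ := exists_sublist_of_mask ((List.range (2 * N φ)).map S) (numbers φ)
    refine ⟨l', hl', ?_⟩
    simp only
    rw [hsum, numbers, List.range_eq_range', maskSum_map_range, ← hS, selSum]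
    refine sum_congr rfl fun k hk => ?_
    rw [← List.range_eq_range', List.getD_eq_getElem _ _ (by simpa using hk)]
    simp

/-! ### Small bricks: the power of four of a unary exponent -/

/-- `pow4F 1ᵉ = ⌜4ᵉ⌝` (`⟦1ᵉ 1ᵉ⟧ + 1 = 2^{2e}`). [folklore] -/
def pow4F : List Bool → List Bool := addFn ∘ fanoutFn (fun u => u ++ u) (fun _ => [true])

/-- `pow4F ∈ FP`. [folklore] -/
theorem pow4F_mem_FP : pow4F ∈ FP :=
  comp_mem_FP addFn_mem_FP (fanoutFn_mem_FP (append_mem_FP OracleCompose.id_mem_FP OracleCompose.id_mem_FP) (const_mem_FP _))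

/-- **`pow4F (ones e) = ⌜4ᵉ⌝`.** [folklore] -/
@[simp] theorem pow4F_ones (e : ℕ) : pow4F (ones e) = encodeNat (4 ^ e) := by
  rw [pow4F, Function.comp_apply, fanoutFn_apply, addFn_boolPair, Com.ones_append, bitsToNat_ones, bitsToNat_singleton_true,
    Nat.sub_add_cancel Nat.one_le_two_pow, show (4 : ℕ) = 2 ^ 2 by norm_num, ← pow_mul, two_mul]

/-- `|⌜m⌝| ≤ k ↔ m < 2ᵏ` (twin of `QuadCong.length_encodeNat_le_iff`, sibling machine file, not imported). [folklore] -/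
theorem length_encodeNat_le_iff' {m k : ℕ} : (encodeNat m).length ≤ k ↔ m < 2 ^ k := by
  rw [TM2Pass.length_encodeNat_eq_size, Nat.size_le]

/-! ### Accessors by occurrence index on `q = ⟨w, 1ᵃ⟩` -/

/-- Item `i` of a list code by iterated second projections (twin of
`OneInThreeMaxCut.fstF_iterate_sndF_encList`, `MaxCutGadgetMachine.lean`, not imported). [folklore] -/
theorem fstF_iterate_sndF_encList' (l : List (List Bool)) :
    ∀ (i : ℕ) (hi : i < l.length), fstF (sndF^[i] (encList l)) = l[i] := by
  induction l with
  | nil => intro i hi; simp at hi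
  | cons a l ih =>
    intro i hi
    cases i with
    | zero => simp [encList_cons]
    | succ i =>
      rw [Function.iterate_succ_apply, encList_cons, sndF_boolPair, List.getElem_cons_succ]
      exact ih i (by simpa using hi)

/-- The iterated-pair list code `OracleCompose.body` is `encList` (local copy of
`Brick.body_eq_encList`, `GoldwasserSipserRefereeBricks.lean`, not imported). [folklore] -/
theorem body_eq_encList₃ (L : List (List Bool)) : OracleCompose.body L = encList L := by
  induction L with
  | nil => rfl
  | cons a L ih => rw [OracleCompose.body_cons, encList_cons, ih]

/-- `1ᵐ` (the header of the CNF code `w`). [folklore] -/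
def mU : List Bool → List Bool := fstF

/-- `1ᴺ = 1^{3m}`. [folklore] -/
def NU : List Bool → List Bool := fun w => mU w ++ (mU w ++ mU w)

/-- On `q = ⟨w, 1ᵃ⟩`: `⟨1^{a/3}, 1^{a%3}⟩`. [folklore] -/
def dmF : List Bool → List Bool := divModFn ∘ fanoutFn (fun _ => ones 3) sndF

/-- On `q`: the code of clause `a / 3`. [folklore] -/
def clF : List Bool → List Bool := Ladder3.aF ∘ fanoutFn fstF (fstF ∘ dmF)

/-- On `q`: the code of the literal at occurrence `a` (item `a % 3` of clause `a / 3`). [cite: Sipser2012, Thm 7.56 (proof)] -/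
def litF : List Bool → List Bool := nthItemFn ∘ fanoutFn (sndF ∘ dmF) (sndF ∘ clF)

/-- On `q`: the numeral of the variable of occurrence `a`. [folklore] -/
def vaF : List Bool → List Bool := fstF ∘ litF

/-- On `q`: the polarity bit of occurrence `a`. [folklore] -/
def poF : List Bool → List Bool := headBitFn ∘ sndF ∘ litF

/-- On `q`: `1^{a/3}`. [folklore] -/
def a3U : List Bool → List Bool := fstF ∘ dmF

/-- `mU ∈ FP`. [folklore] -/
theorem mU_mem_FP : mU ∈ FP := fstF_mem_FP

/-- `NU ∈ FP`. [folklore] -/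
theorem NU_mem_FP : NU ∈ FP := append_mem_FP mU_mem_FP (append_mem_FP mU_mem_FP mU_mem_FP)

/-- `dmF ∈ FP`. [folklore] -/
theorem dmF_mem_FP : dmF ∈ FP := comp_mem_FP divModFn_mem_FP (fanoutFn_mem_FP (const_mem_FP _) sndF_mem_FP)

/-- `clF ∈ FP`. [folklore] -/
theorem clF_mem_FP : clF ∈ FP := comp_mem_FP Ladder3.aF_mem_FP (fanoutFn_mem_FP fstF_mem_FP (comp_mem_FP fstF_mem_FP dmF_mem_FP))

/-- `litF ∈ FP`. [folklore] -/
theorem litF_mem_FP : litF ∈ FP :=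
  comp_mem_FP nthItemFn_mem_FP (fanoutFn_mem_FP (comp_mem_FP sndF_mem_FP dmF_mem_FP) (comp_mem_FP sndF_mem_FP clF_mem_FP))

/-- `vaF ∈ FP`. [folklore] -/
theorem vaF_mem_FP : vaF ∈ FP := comp_mem_FP fstF_mem_FP litF_mem_FP

/-- `poF ∈ FP`. [folklore] -/
theorem poF_mem_FP : poF ∈ FP := comp_mem_FP headBitFn_mem_FP (comp_mem_FP sndF_mem_FP litF_mem_FP)

/-- `a3U ∈ FP`. [folklore] -/
theorem a3U_mem_FP : a3U ∈ FP := comp_mem_FP fstF_mem_FP dmF_mem_FP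

section accessorValues

variable (φ : CNF ℕ)

/-- The header of a CNF code is `1ᵐ`. [folklore] -/
@[simp] theorem mU_encode : mU (encodingCNF.encode φ) = ones φ.length := by
  rw [mU, encodeCNF_eq, fstF_boolPair]

/-- `NU (encode φ) = 1ᴺ`. [folklore] -/
@[simp] theorem NU_encode : NU (encodingCNF.encode φ) = ones (N φ) := by
  rw [NU, mU_encode, Com.ones_append, Com.ones_append, N]; congr 1; ring

/-- `dmF ⟨w, 1ᵃ⟩ = ⟨1^{a/3}, 1^{a%3}⟩`. [folklore] -/
@[simp] theorem dmF_apply (w : List Bool) (a : ℕ) : dmF (boolPair w (ones a)) = boolPair (ones (a / 3)) (ones (a % 3)) := by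
  rw [dmF, Function.comp_apply, fanoutFn_apply, sndF_boolPair, divModFn_boolPair]

/-- `a3U ⟨w, 1ᵃ⟩ = 1^{a/3}`. [folklore] -/
@[simp] theorem a3U_apply (w : List Bool) (a : ℕ) : a3U (boolPair w (ones a)) = ones (a / 3) := by
  simp [a3U]

/-- **The clause code at occurrence `a`** (clause `a / 3 < m`). [folklore] -/
theorem clF_apply {a : ℕ} (hi : a / 3 < φ.length) :
    clF (boolPair (encodingCNF.encode φ) (ones a)) = encodingClause.encode (φ[a / 3]) := by
  rw [clF, Function.comp_apply, fanoutFn_apply, fstF_boolPair, Function.comp_apply, dmF_apply, fstF_boolPair,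
    Ladder3.aF_boolPair, encodeCNF_eq, sndF_boolPair, fstF_iterate_sndF_encList' _ _ (by simpa using hi)]
  simp

/-- **The literal at occurrence `a < N`** (three literals per clause): `lit φ a` is the `a % 3`-th
literal of clause `a / 3`, and `litF` returns its code. [cite: Sipser2012, Thm 7.56 (proof)] -/
theorem litF_apply (h3 : ∀ c ∈ φ, c.length = 3) {a : ℕ} (ha : a < N φ) :
    litF (boolPair (encodingCNF.encode φ) (ones a)) = boolPair (encodeNat (var φ a)) [pol φ a] := by
  have hi : a / 3 < φ.length := by unfold N at ha; omega
  have hC : (φ[a / 3]).length = 3 := h3 _ (List.getElem_mem hi)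
  have hj : a % 3 < (φ[a / 3]).length := by rw [hC]; exact Nat.mod_lt _ (by norm_num)
  have hlit : lit φ a = (φ[a / 3])[a % 3] := by
    unfold lit; rw [List.getD_eq_getElem _ _ hi, List.getD_eq_getElem _ _ hj]
  rw [litF, Function.comp_apply, fanoutFn_apply, Function.comp_apply, dmF_apply, sndF_boolPair, Function.comp_apply,
    clF_apply φ hi, encodeClause_eq, sndF_boolPair, ← body_eq_encList₃, nthItemFn_body,
    List.getD_eq_getElem _ _ (by simpa using hj), List.getElem_map, encodeLit_eq, var, pol, hlit]

/-- `vaF` at occurrence `a < N`. [folklore] -/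
theorem vaF_apply (h3 : ∀ c ∈ φ, c.length = 3) {a : ℕ} (ha : a < N φ) :
    vaF (boolPair (encodingCNF.encode φ) (ones a)) = encodeNat (var φ a) := by
  rw [vaF, Function.comp_apply, litF_apply φ h3 ha, fstF_boolPair]

/-- `poF` at occurrence `a < N`. [folklore] -/
theorem poF_apply (h3 : ∀ c ∈ φ, c.length = 3) {a : ℕ} (ha : a < N φ) :
    poF (boolPair (encodingCNF.encode φ) (ones a)) = [pol φ a] := by
  rw [poF, Function.comp_apply, Function.comp_apply, litF_apply φ h3 ha, sndF_boolPair, headBitFn_apply]; rfl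

end accessorValues

/-! ### The digit terms on `r = ⟨⟨w, 1ᵃ⟩, 1ᵇ⟩` -/

/-- On `r`: `⟨w, 1ᵇ⟩`. [folklore] -/
def qbF : List Bool → List Bool := fanoutFn (fstF ∘ fstF) sndF

/-- On `r`: `[var a = var b]` (canonical numerals compared as strings). [cite: Sipser2012, Thm 7.56 (proof)] -/
def eqF : List Bool → List Bool := eqPairFn ∘ fanoutFn (vaF ∘ fstF) (vaF ∘ qbF)

/-- On `r`: the code `w`. [folklore] -/
def wR : List Bool → List Bool := fstF ∘ fstF

/-- On `r`: `1^{aN}`. [folklore] -/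
def aNU : List Bool → List Bool := umulFn ∘ fanoutFn (sndF ∘ fstF) (NU ∘ wR)

/-- On `r`: `1^{bN}`. [folklore] -/
def bNU : List Bool → List Bool := umulFn ∘ fanoutFn sndF (NU ∘ wR)

/-- On `r`: `1^{pos a b} = 1ᵐ 1^{aN} 1ᵇ`. [cite: Sipser2012, Thm 7.56 (proof: digit positions)] -/
def posAB : List Bool → List Bool := fun r => (mU ∘ wR) r ++ (aNU r ++ sndF r)

/-- On `r`: `1^{pos b a} = 1ᵐ 1^{bN} 1ᵃ`. [cite: Sipser2012, Thm 7.56 (proof: digit positions)] -/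
def posBA : List Bool → List Bool := fun r => (mU ∘ wR) r ++ (bNU r ++ (sndF ∘ fstF) r)

/-- On `r`: the term `[var a = var b] · 4^{pos a b}` of `numT a` (`ε` for `0`). [cite: Sipser2012, Thm 7.56 (proof)] -/
def termT : List Bool → List Bool := iteFn eqF (pow4F ∘ posAB) (fun _ => [])

/-- On `r`: the term `[var a = var b] · 4^{pos b a}` of `numF a`. [cite: Sipser2012, Thm 7.56 (proof)] -/
def termF : List Bool → List Bool := iteFn eqF (pow4F ∘ posBA) (fun _ => [])

/-- `qbF ∈ FP`. [folklore] -/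
theorem qbF_mem_FP : qbF ∈ FP := fanoutFn_mem_FP (comp_mem_FP fstF_mem_FP fstF_mem_FP) sndF_mem_FP

/-- `eqF ∈ FP`. [folklore] -/
theorem eqF_mem_FP : eqF ∈ FP :=
  comp_mem_FP eqPairFn_mem_FP (fanoutFn_mem_FP (comp_mem_FP vaF_mem_FP fstF_mem_FP) (comp_mem_FP vaF_mem_FP qbF_mem_FP))

/-- `eqF` is one-bit. [folklore] -/
theorem oneBit_eqF : OneBit eqF := oneBit_eqPairFn.comp _

/-- `wR ∈ FP`. [folklore] -/
theorem wR_mem_FP : wR ∈ FP := comp_mem_FP fstF_mem_FP fstF_mem_FP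

/-- `aNU ∈ FP`. [folklore] -/
theorem aNU_mem_FP : aNU ∈ FP :=
  comp_mem_FP umulFn_mem_FP (fanoutFn_mem_FP (comp_mem_FP sndF_mem_FP fstF_mem_FP) (comp_mem_FP NU_mem_FP wR_mem_FP))

/-- `bNU ∈ FP`. [folklore] -/
theorem bNU_mem_FP : bNU ∈ FP := comp_mem_FP umulFn_mem_FP (fanoutFn_mem_FP sndF_mem_FP (comp_mem_FP NU_mem_FP wR_mem_FP))

/-- `posAB ∈ FP`. [folklore] -/
theorem posAB_mem_FP : posAB ∈ FP :=
  append_mem_FP (comp_mem_FP mU_mem_FP wR_mem_FP) (append_mem_FP aNU_mem_FP sndF_mem_FP)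

/-- `posBA ∈ FP`. [folklore] -/
theorem posBA_mem_FP : posBA ∈ FP :=
  append_mem_FP (comp_mem_FP mU_mem_FP wR_mem_FP) (append_mem_FP bNU_mem_FP (comp_mem_FP sndF_mem_FP fstF_mem_FP))

/-- `termT ∈ FP`. [folklore] -/
theorem termT_mem_FP : termT ∈ FP := iteFn_mem_FP eqF_mem_FP (comp_mem_FP pow4F_mem_FP posAB_mem_FP) (const_mem_FP _)

/-- `termF ∈ FP`. [folklore] -/
theorem termF_mem_FP : termF ∈ FP := iteFn_mem_FP eqF_mem_FP (comp_mem_FP pow4F_mem_FP posBA_mem_FP) (const_mem_FP _)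

section termValues

variable (φ : CNF ℕ) (h3 : ∀ c ∈ φ, c.length = 3)
include h3

/-- `eqF ⟨⟨w, 1ᵃ⟩, 1ᵇ⟩ = [var a = var b]`. [folklore] -/
theorem eqF_apply {a b : ℕ} (ha : a < N φ) (hb : b < N φ) :
    eqF (boolPair (boolPair (encodingCNF.encode φ) (ones a)) (ones b)) = [decide (var φ a = var φ b)] := by
  simp only [eqF, qbF, Function.comp_apply, fanoutFn_apply, fstF_boolPair, sndF_boolPair, vaF_apply φ h3 ha,
    vaF_apply φ h3 hb, eqPairFn_boolPair]
  rw [Bool.decide_congr encodeNat_inj]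

omit h3 in
/-- `posAB ⟨⟨w, 1ᵃ⟩, 1ᵇ⟩ = 1^{pos a b}`. [folklore] -/
@[simp] theorem posAB_apply (a b : ℕ) :
    posAB (boolPair (boolPair (encodingCNF.encode φ) (ones a)) (ones b)) = ones (pos φ a b) := by
  simp only [posAB, wR, aNU, Function.comp_apply, fanoutFn_apply, fstF_boolPair, sndF_boolPair, mU_encode, NU_encode,
    umulFn_boolPair, Com.ones_append, pos, Nat.add_assoc]

omit h3 in
/-- `posBA ⟨⟨w, 1ᵃ⟩, 1ᵇ⟩ = 1^{pos b a}`. [folklore] -/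
@[simp] theorem posBA_apply (a b : ℕ) :
    posBA (boolPair (boolPair (encodingCNF.encode φ) (ones a)) (ones b)) = ones (pos φ b a) := by
  simp only [posBA, wR, bNU, Function.comp_apply, fanoutFn_apply, fstF_boolPair, sndF_boolPair, mU_encode, NU_encode,
    umulFn_boolPair, Com.ones_append, pos, Nat.add_assoc]

/-- **`termT` at `(a, b)`**: `⟦termT⟧ = [var a = var b] 4^{pos a b}`. [cite: Sipser2012, Thm 7.56 (proof)] -/
theorem termT_apply {a b : ℕ} (ha : a < N φ) (hb : b < N φ) :
    termT (boolPair (boolPair (encodingCNF.encode φ) (ones a)) (ones b)) =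
      if var φ a = var φ b then encodeNat (4 ^ pos φ a b) else [] := by
  rw [termT, iteFn_apply (eqF_apply φ h3 ha hb)]
  by_cases h : var φ a = var φ b <;> simp [h]

/-- **`termF` at `(a, b)`**: `⟦termF⟧ = [var a = var b] 4^{pos b a}`. [cite: Sipser2012, Thm 7.56 (proof)] -/
theorem termF_apply {a b : ℕ} (ha : a < N φ) (hb : b < N φ) :
    termF (boolPair (boolPair (encodingCNF.encode φ) (ones a)) (ones b)) =
      if var φ a = var φ b then encodeNat (4 ^ pos φ b a) else [] := by
  rw [termF, iteFn_apply (eqF_apply φ h3 ha hb)]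
  by_cases h : var φ a = var φ b <;> simp [h]

end termValues

/-! ### The numbers `numT a`, `numF a` on `q = ⟨w, 1ᵃ⟩` -/

/-- The clip polynomial: every numeral of the computation has at most `40 (L+1)²` symbols. [folklore] -/
def Zp : Polynomial ℕ := 40 * (X + 1) ^ 2

/-- `Zp.eval L = 40 (L+1)²`. [folklore] -/
@[simp] theorem eval_Zp (L : ℕ) : Zp.eval L = 40 * (L + 1) ^ 2 := by simp [Zp]

/-- On `q`: `⟨q, 1ᴺ⟩`. [folklore] -/
def inT : List Bool → List Bool := fanoutFn id (NU ∘ fstF)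

/-- On `q`: **`⌜∑_{b<N} [var a = var b] 4^{pos a b}⌝`.** [cite: Sipser2012, Thm 7.56 (proof: the row yᵢ)] -/
def sumT : List Bool → List Bool := foldSum Zp (3 * X) termT ∘ inT

/-- On `q`: **`⌜∑_{b<N} [var a = var b] 4^{pos b a}⌝`.** [cite: Sipser2012, Thm 7.56 (proof: the row zᵢ)] -/
def sumFq : List Bool → List Bool := foldSum Zp (3 * X) termF ∘ inT

/-- On `q`: `[pol a] · 4^{a/3}`. [cite: Sipser2012, Thm 7.56 (proof: the clause digit)] -/
def headT : List Bool → List Bool := iteFn poF (pow4F ∘ a3U) (fun _ => [])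

/-- On `q`: `[¬ pol a] · 4^{a/3}`. [cite: Sipser2012, Thm 7.56 (proof: the clause digit)] -/
def headF : List Bool → List Bool := iteFn poF (fun _ => []) (pow4F ∘ a3U)

/-- On `q`: **`⌜numT a⌝`.** [cite: Sipser2012, Thm 7.56 (proof: the row yᵢ)] -/
def numTF : List Bool → List Bool := addFn ∘ fanoutFn headT sumT

/-- On `q`: **`⌜numF a⌝`.** [cite: Sipser2012, Thm 7.56 (proof: the row zᵢ)] -/
def numFF : List Bool → List Bool := addFn ∘ fanoutFn headF sumFq

/-- `inT ∈ FP`. [folklore] -/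
theorem inT_mem_FP : inT ∈ FP := fanoutFn_mem_FP OracleCompose.id_mem_FP (comp_mem_FP NU_mem_FP fstF_mem_FP)

/-- `sumT ∈ FP`. [cite: AroraBarak2009, §1.3] -/
theorem sumT_mem_FP : sumT ∈ FP := comp_mem_FP (foldSum_mem_FP _ _ termT_mem_FP) inT_mem_FP

/-- `sumFq ∈ FP`. [cite: AroraBarak2009, §1.3] -/
theorem sumFq_mem_FP : sumFq ∈ FP := comp_mem_FP (foldSum_mem_FP _ _ termF_mem_FP) inT_mem_FP

/-- `headT ∈ FP`. [folklore] -/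
theorem headT_mem_FP : headT ∈ FP := iteFn_mem_FP poF_mem_FP (comp_mem_FP pow4F_mem_FP a3U_mem_FP) (const_mem_FP _)

/-- `headF ∈ FP`. [folklore] -/
theorem headF_mem_FP : headF ∈ FP := iteFn_mem_FP poF_mem_FP (const_mem_FP _) (comp_mem_FP pow4F_mem_FP a3U_mem_FP)

/-- `numTF ∈ FP`. [folklore] -/
theorem numTF_mem_FP : numTF ∈ FP := comp_mem_FP addFn_mem_FP (fanoutFn_mem_FP headT_mem_FP sumT_mem_FP)

/-- `numFF ∈ FP`. [folklore] -/
theorem numFF_mem_FP : numFF ∈ FP := comp_mem_FP addFn_mem_FP (fanoutFn_mem_FP headF_mem_FP sumFq_mem_FP)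

section sizes

variable (φ : CNF ℕ)

/-- `m ≤ |encode φ|` (indeed `2m + 2 ≤`). [folklore] -/
theorem two_mul_length_le : 2 * φ.length + 2 ≤ (encodingCNF.encode φ).length := by
  rw [encodeCNF_eq, length_boolPair, List.length_replicate]; omega

/-- `D + N + 1 ≤ 13 (m+1)²`, so `4^{D+N+1} ≤ 2^{Zp (|w|)}`… in the form used: `2 (D + N + 1) ≤ Zp (|encode φ|)`. [folklore] -/
theorem two_mul_D_le : 2 * (D φ + N φ + 1) ≤ Zp.eval (encodingCNF.encode φ).length := by
  rw [eval_Zp]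
  have h := two_mul_length_le φ
  unfold D N
  nlinarith [h, Nat.zero_le φ.length]

/-- A sum of at most `N + 1` digits `≤ 4^{D-1}`-ish is `< 4^{D+N+1}`: the crude bound
`x ≤ (N + 1) 4^D → x < 2^{2(D+N+1)}`. [folklore] -/
theorem lt_two_pow_of_le {x : ℕ} (hx : x ≤ (N φ + 1) * 4 ^ D φ) : x < 2 ^ (2 * (D φ + N φ + 1)) := by
  rw [pow_mul, show (2 : ℕ) ^ 2 = 4 by norm_num, pow_add, pow_add, pow_one]
  have h1 : N φ + 1 < 4 ^ N φ * 4 := by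
    have := Nat.lt_pow_self (n := N φ) (by norm_num : 1 < 4); omega
  calc x ≤ (N φ + 1) * 4 ^ D φ := hx
    _ < 4 ^ N φ * 4 * 4 ^ D φ := Nat.mul_lt_mul_of_pos_right h1 (by positivity)
    _ = 4 ^ D φ * 4 ^ N φ * 4 := by ring

/-- The inner sums are small: `∑_{b<N} [var a = var b] 4^{pos a b} ≤ N · 4^D` (any `a < N`). [folklore] -/
theorem sum_pos_le {a : ℕ} (g : ℕ → ℕ → ℕ) (hg : ∀ b < N φ, g a b < D φ) :
    ∑ b ∈ range (N φ), (if var φ a = var φ b then 4 ^ g a b else 0) ≤ N φ * 4 ^ D φ := by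
  calc ∑ b ∈ range (N φ), (if var φ a = var φ b then 4 ^ g a b else 0) ≤ ∑ _b ∈ range (N φ), 4 ^ D φ := by
        refine sum_le_sum fun b hb => ?_
        split_ifs
        · exact Nat.pow_le_pow_right (by norm_num) (hg b (mem_range.1 hb)).le
        · exact Nat.zero_le _
    _ = N φ * 4 ^ D φ := by rw [sum_const, card_range, smul_eq_mul]

end sizes

section numValues

variable (φ : CNF ℕ) (h3 : ∀ c ∈ φ, c.length = 3)
include h3

/-- **`sumT ⟨w, 1ᵃ⟩`** for `a < N`. [cite: Sipser2012, Thm 7.56 (proof)] -/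
theorem sumT_apply {a : ℕ} (ha : a < N φ) :
    sumT (boolPair (encodingCNF.encode φ) (ones a)) =
      encodeNat (∑ b ∈ range (N φ), if var φ a = var φ b then 4 ^ pos φ a b else 0) := by
  rw [sumT, Function.comp_apply, inT, fanoutFn_apply, id, Function.comp_apply, fstF_boolPair, NU_encode, foldSum_apply]
  · rw [List.length_replicate]
    exact congrArg encodeNat (sum_congr rfl fun b hb => by
      rw [termT_apply φ h3 ha (mem_range.1 hb)]; split_ifs <;> simp)
  · rw [List.length_replicate, length_boolPair, eval_mul, eval_ofNat, eval_X]; have := two_mul_length_le φ; unfold N; omega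
  · intro t ht
    rw [List.length_replicate] at ht
    rw [termT_apply φ h3 ha ht, length_boolPair]
    have hmono := TM2Iter.eval_mono Zp
      (show (encodingCNF.encode φ).length ≤ 2 * (encodingCNF.encode φ).length + 2 + (ones a).length by omega)
    split_ifs
    · rw [length_encodeNat_le_iff']
      refine lt_of_lt_of_le (lt_two_pow_of_le φ ?_) ((Nat.pow_le_pow_right (by norm_num) (two_mul_D_le φ)).trans
        (Nat.pow_le_pow_right (by norm_num) hmono))
      have := pos_lt_D (φ := φ) ha ht
      calc 4 ^ pos φ a t ≤ 4 ^ D φ := Nat.pow_le_pow_right (by norm_num) this.le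
        _ ≤ (N φ + 1) * 4 ^ D φ := Nat.le_mul_of_pos_left _ (Nat.succ_pos _)
    · exact Nat.zero_le _

/-- **`sumFq ⟨w, 1ᵃ⟩`** for `a < N`. [cite: Sipser2012, Thm 7.56 (proof)] -/
theorem sumFq_apply {a : ℕ} (ha : a < N φ) :
    sumFq (boolPair (encodingCNF.encode φ) (ones a)) =
      encodeNat (∑ b ∈ range (N φ), if var φ a = var φ b then 4 ^ pos φ b a else 0) := by
  rw [sumFq, Function.comp_apply, inT, fanoutFn_apply, id, Function.comp_apply, fstF_boolPair, NU_encode, foldSum_apply]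
  · rw [List.length_replicate]
    exact congrArg encodeNat (sum_congr rfl fun b hb => by
      rw [termF_apply φ h3 ha (mem_range.1 hb)]; split_ifs <;> simp)
  · rw [List.length_replicate, length_boolPair, eval_mul, eval_ofNat, eval_X]; have := two_mul_length_le φ; unfold N; omega
  · intro t ht
    rw [List.length_replicate] at ht
    rw [termF_apply φ h3 ha ht, length_boolPair]
    have hmono := TM2Iter.eval_mono Zp
      (show (encodingCNF.encode φ).length ≤ 2 * (encodingCNF.encode φ).length + 2 + (ones a).length by omega)
    split_ifs
    · rw [length_encodeNat_le_iff']
      refine lt_of_lt_of_le (lt_two_pow_of_le φ ?_) ((Nat.pow_le_pow_right (by norm_num) (two_mul_D_le φ)).trans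
        (Nat.pow_le_pow_right (by norm_num) hmono))
      have := pos_lt_D (φ := φ) ht ha
      calc 4 ^ pos φ t a ≤ 4 ^ D φ := Nat.pow_le_pow_right (by norm_num) this.le
        _ ≤ (N φ + 1) * 4 ^ D φ := Nat.le_mul_of_pos_left _ (Nat.succ_pos _)
    · exact Nat.zero_le _

/-- `headT ⟨w, 1ᵃ⟩`. [folklore] -/
theorem headT_apply {a : ℕ} (ha : a < N φ) :
    headT (boolPair (encodingCNF.encode φ) (ones a)) = if pol φ a = true then encodeNat (4 ^ (a / 3)) else [] := by
  rw [headT, iteFn_apply (poF_apply φ h3 ha)]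
  cases pol φ a <;> simp

/-- `headF ⟨w, 1ᵃ⟩`. [folklore] -/
theorem headF_apply {a : ℕ} (ha : a < N φ) :
    headF (boolPair (encodingCNF.encode φ) (ones a)) = if pol φ a = false then encodeNat (4 ^ (a / 3)) else [] := by
  rw [headF, iteFn_apply (poF_apply φ h3 ha)]
  cases pol φ a <;> simp

/-- **`numTF ⟨w, 1ᵃ⟩ = ⌜numT a⌝`** for `a < N`. [cite: Sipser2012, Thm 7.56 (proof: the row yᵢ)] -/
theorem numTF_apply {a : ℕ} (ha : a < N φ) : numTF (boolPair (encodingCNF.encode φ) (ones a)) = encodeNat (numT φ a) := by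
  rw [numTF, Function.comp_apply, fanoutFn_apply, headT_apply φ h3 ha, sumT_apply φ h3 ha, addFn_boolPair, bitsToNat_encodeNat,
    numT]
  congr 1
  cases pol φ a <;> simp

/-- **`numFF ⟨w, 1ᵃ⟩ = ⌜numF a⌝`** for `a < N`. [cite: Sipser2012, Thm 7.56 (proof: the row zᵢ)] -/
theorem numFF_apply {a : ℕ} (ha : a < N φ) : numFF (boolPair (encodingCNF.encode φ) (ones a)) = encodeNat (numF φ a) := by
  rw [numFF, Function.comp_apply, fanoutFn_apply, headF_apply φ h3 ha, sumFq_apply φ h3 ha, addFn_boolPair, bitsToNat_encodeNat,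
    numF]
  congr 1
  cases pol φ a <;> simp

omit h3 in
/-- `numT a ≤ (N + 1) 4^D`. [folklore] -/
theorem numT_le {a : ℕ} (ha : a < N φ) : numT φ a ≤ (N φ + 1) * 4 ^ D φ := by
  unfold numT
  have h1 : (if pol φ a = true then 4 ^ (a / 3) else 0) ≤ 4 ^ D φ := by
    split_ifs
    · exact Nat.pow_le_pow_right (by norm_num) (div_three_lt_D (φ := φ) ha).le
    · exact Nat.zero_le _
  have h2 := sum_pos_le φ (pos φ) (fun b hb => pos_lt_D (φ := φ) ha hb)
  nlinarith

omit h3 in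
/-- `numF a ≤ (N + 1) 4^D`. [folklore] -/
theorem numF_le {a : ℕ} (ha : a < N φ) : numF φ a ≤ (N φ + 1) * 4 ^ D φ := by
  unfold numF
  have h1 : (if pol φ a = false then 4 ^ (a / 3) else 0) ≤ 4 ^ D φ := by
    split_ifs
    · exact Nat.pow_le_pow_right (by norm_num) (div_three_lt_D (φ := φ) ha).le
    · exact Nat.zero_le _
  have h2 := sum_pos_le φ (fun a b => pos φ b a) (fun b hb => pos_lt_D (φ := φ) hb ha)
  nlinarith

end numValues

/-! ### The list `numbers φ` and the target on `w` -/

/-- On `s = ⟨w, 1ᵏ⟩`: `⟨1^{k/2}, 1^{k%2}⟩`. [folklore] -/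
def hkF : List Bool → List Bool := divModFn ∘ fanoutFn (fun _ => ones 2) sndF

/-- On `s`: `⟨w, 1^{k/2}⟩`. [folklore] -/
def qkF : List Bool → List Bool := fanoutFn fstF (fstF ∘ hkF)

/-- On `s`: **`⌜numAt k⌝`** (`numF (k/2)` for even `k`, `numT (k/2)` for odd `k`). [cite: Sipser2012, Thm 7.56 (proof)] -/
def numAtF : List Bool → List Bool := iteFn (isNilFn ∘ sndF ∘ hkF) (numFF ∘ qkF) (numTF ∘ qkF)

/-- **The coded list of `numbers φ`** (`foldCat` of the framed numerals over `k < 2N`). [cite: Sipser2012, Thm 7.56 (proof: "the elements of S")] -/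
def numbersF : List Bool → List Bool :=
  foldCat (2 * Zp + 2) (3 * X) (Ladder3.frameF numAtF) ∘ fanoutFn id (fun w => NU w ++ NU w)

/-- `⌜∑_{i<m} 4ⁱ⌝` (the clause digits of the target). [cite: Sipser2012, Thm 7.56 (proof: the row t)] -/
def tgt1F : List Bool → List Bool := foldSum Zp (3 * X) (pow4F ∘ sndF) ∘ fanoutFn id mU

/-- `⌜∑_{a<N} ∑_{b<N} [var a = var b] 4^{pos a b}⌝` (the consistency digits of the target). [cite: Sipser2012, Thm 7.56 (proof: the row t)] -/
def tgt2F : List Bool → List Bool := foldSum Zp (3 * X) sumT ∘ fanoutFn id NU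

/-- **`⌜target φ⌝`.** [cite: Sipser2012, Thm 7.56 (proof: the row t)] -/
def targetF : List Bool → List Bool := addFn ∘ fanoutFn tgt1F tgt2F

/-- **The transformation on codes** (unguarded): the KNAPSACK code `⟨⟨1^{2N}, numbers⟩, ⌜target⌝⟩`.
[cite: Sipser2012, Thm 7.56] [cite: Karp1972, §4 (problem 18)] -/
def outKF : List Bool → List Bool := fanoutFn (fanoutFn (fun w => NU w ++ NU w) numbersF) targetF

/-- `hkF ∈ FP`. [folklore] -/
theorem hkF_mem_FP : hkF ∈ FP := comp_mem_FP divModFn_mem_FP (fanoutFn_mem_FP (const_mem_FP _) sndF_mem_FP)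

/-- `qkF ∈ FP`. [folklore] -/
theorem qkF_mem_FP : qkF ∈ FP := fanoutFn_mem_FP fstF_mem_FP (comp_mem_FP fstF_mem_FP hkF_mem_FP)

/-- `numAtF ∈ FP`. [folklore] -/
theorem numAtF_mem_FP : numAtF ∈ FP :=
  iteFn_mem_FP (comp_mem_FP isNilFn_mem_FP (comp_mem_FP sndF_mem_FP hkF_mem_FP)) (comp_mem_FP numFF_mem_FP qkF_mem_FP)
    (comp_mem_FP numTF_mem_FP qkF_mem_FP)

/-- `numbersF ∈ FP`. [cite: AroraBarak2009, §1.3] -/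
theorem numbersF_mem_FP : numbersF ∈ FP :=
  comp_mem_FP (foldCat_mem_FP _ _ (Ladder3.frameF_mem_FP numAtF_mem_FP))
    (fanoutFn_mem_FP OracleCompose.id_mem_FP (append_mem_FP NU_mem_FP NU_mem_FP))

/-- `tgt1F ∈ FP`. [folklore] -/
theorem tgt1F_mem_FP : tgt1F ∈ FP :=
  comp_mem_FP (foldSum_mem_FP _ _ (comp_mem_FP pow4F_mem_FP sndF_mem_FP)) (fanoutFn_mem_FP OracleCompose.id_mem_FP mU_mem_FP)

/-- `tgt2F ∈ FP`. [folklore] -/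
theorem tgt2F_mem_FP : tgt2F ∈ FP :=
  comp_mem_FP (foldSum_mem_FP _ _ sumT_mem_FP) (fanoutFn_mem_FP OracleCompose.id_mem_FP NU_mem_FP)

/-- `targetF ∈ FP`. [folklore] -/
theorem targetF_mem_FP : targetF ∈ FP := comp_mem_FP addFn_mem_FP (fanoutFn_mem_FP tgt1F_mem_FP tgt2F_mem_FP)

/-- **`outKF ∈ FP`.** [cite: Sipser2012, Thm 7.56 ("in polynomial time")] [cite: AroraBarak2009, §1.3] -/
theorem outKF_mem_FP : outKF ∈ FP :=
  fanoutFn_mem_FP (fanoutFn_mem_FP (append_mem_FP NU_mem_FP NU_mem_FP) numbersF_mem_FP) targetF_mem_FP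

section listValues

variable (φ : CNF ℕ) (h3 : ∀ c ∈ φ, c.length = 3)
include h3

/-- **`numAtF ⟨w, 1ᵏ⟩ = ⌜numAt k⌝`** for `k < 2N`. [cite: Sipser2012, Thm 7.56 (proof)] -/
theorem numAtF_apply {k : ℕ} (hk : k < 2 * N φ) : numAtF (boolPair (encodingCNF.encode φ) (ones k)) = encodeNat (numAt φ k) := by
  have hh : hkF (boolPair (encodingCNF.encode φ) (ones k)) = boolPair (ones (k / 2)) (ones (k % 2)) := by
    rw [hkF, Function.comp_apply, fanoutFn_apply, sndF_boolPair, divModFn_boolPair]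
  have hq : qkF (boolPair (encodingCNF.encode φ) (ones k)) = boolPair (encodingCNF.encode φ) (ones (k / 2)) := by
    rw [qkF, fanoutFn_apply, fstF_boolPair, Function.comp_apply, hh, fstF_boolPair]
  have ha : k / 2 < N φ := by omega
  have hc : (isNilFn ∘ sndF ∘ hkF) (boolPair (encodingCNF.encode φ) (ones k)) = [decide (k % 2 = 0)] := by
    rw [Function.comp_apply, Function.comp_apply, hh, sndF_boolPair]
    simp [isNilFn, ones]
  rw [numAtF, iteFn_apply hc, numAt]
  by_cases h : k % 2 = 0
  · rw [if_pos (decide_eq_true h), if_neg (by omega), Function.comp_apply, hq, numFF_apply φ h3 ha]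
  · rw [if_neg (by rw [decide_eq_false h]; exact Bool.false_ne_true), if_pos (by omega), Function.comp_apply, hq,
      numTF_apply φ h3 ha]

omit h3 in
/-- `numAt k ≤ (N + 1) 4^D` for `k < 2N`. [folklore] -/
theorem numAt_le {k : ℕ} (hk : k < 2 * N φ) : numAt φ k ≤ (N φ + 1) * 4 ^ D φ := by
  unfold numAt; split_ifs
  · exact numT_le φ (by omega)
  · exact numF_le φ (by omega)

/-- **`numbersF (encode φ)` is the coded list of the numerals of `numbers φ`.** [cite: Sipser2012, Thm 7.56 (proof)] -/
theorem numbersF_encode : numbersF (encodingCNF.encode φ) = encList ((numbers φ).map encodeNat) := by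
  rw [numbersF, Function.comp_apply, fanoutFn_apply, id, NU_encode, Com.ones_append, foldCat_apply]
  · rw [List.length_replicate, numbers, List.map_map, ← two_mul]
    rw [← ccat_frame_eq_encList]
    refine ccat_congr fun k hk => ?_
    rw [Ladder3.frameF_apply, Ladder3.frame_eq, Function.comp_apply, numAtF_apply φ h3 hk]
  · rw [List.length_replicate, eval_mul, eval_ofNat, eval_X]; have := two_mul_length_le φ; unfold N; omega
  · intro t ht
    rw [List.length_replicate, ← two_mul] at ht
    rw [Ladder3.frameF_apply, Ladder3.length_frame, numAtF_apply φ h3 ht, eval_add, eval_mul, eval_ofNat]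
    have h1 : (encodeNat (numAt φ t)).length ≤ Zp.eval (encodingCNF.encode φ).length :=
      length_encodeNat_le_iff'.2 (lt_of_lt_of_le (lt_two_pow_of_le φ (numAt_le φ ht))
        (Nat.pow_le_pow_right (by norm_num) (two_mul_D_le φ)))
    omega

omit h3 in
/-- `tgt1F (encode φ) = ⌜∑_{i<m} 4ⁱ⌝`. [folklore] -/
theorem tgt1F_encode : tgt1F (encodingCNF.encode φ) = encodeNat (∑ i ∈ range φ.length, 4 ^ i) := by
  rw [tgt1F, Function.comp_apply, fanoutFn_apply, id, mU_encode, foldSum_apply]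
  · rw [List.length_replicate]
    exact congrArg encodeNat (sum_congr rfl fun i _ => by rw [Function.comp_apply, sndF_boolPair, pow4F_ones, bitsToNat_encodeNat])
  · rw [List.length_replicate, eval_mul, eval_ofNat, eval_X]; have := two_mul_length_le φ; omega
  · intro t ht
    rw [List.length_replicate] at ht
    rw [Function.comp_apply, sndF_boolPair, pow4F_ones, length_encodeNat_le_iff']
    refine lt_of_lt_of_le ?_ (Nat.pow_le_pow_right (by norm_num) (two_mul_D_le φ))
    rw [pow_mul, show (2 : ℕ) ^ 2 = 4 by norm_num]
    exact Nat.pow_lt_pow_right (by norm_num) (by unfold D; nlinarith)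

/-- `tgt2F (encode φ) = ⌜∑_a ∑_b [var a = var b] 4^{pos a b}⌝`. [folklore] -/
theorem tgt2F_encode : tgt2F (encodingCNF.encode φ) =
    encodeNat (∑ a ∈ range (N φ), ∑ b ∈ range (N φ), if var φ a = var φ b then 4 ^ pos φ a b else 0) := by
  rw [tgt2F, Function.comp_apply, fanoutFn_apply, id, NU_encode, foldSum_apply]
  · rw [List.length_replicate]
    exact congrArg encodeNat (sum_congr rfl fun a ha => by rw [sumT_apply φ h3 (mem_range.1 ha), bitsToNat_encodeNat])
  · rw [List.length_replicate, eval_mul, eval_ofNat, eval_X]; have := two_mul_length_le φ; unfold N; omega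
  · intro t ht
    rw [List.length_replicate] at ht
    rw [sumT_apply φ h3 ht, length_encodeNat_le_iff']
    refine lt_of_lt_of_le (lt_two_pow_of_le φ ?_) (Nat.pow_le_pow_right (by norm_num) (two_mul_D_le φ))
    exact (sum_pos_le φ (pos φ) fun b hb => pos_lt_D (φ := φ) ht hb).trans (Nat.mul_le_mul_right _ (Nat.le_succ _))

/-- **`targetF (encode φ) = ⌜target φ⌝`.** [cite: Sipser2012, Thm 7.56 (proof: the row t)] -/
theorem targetF_encode : targetF (encodingCNF.encode φ) = encodeNat (target φ) := by
  rw [targetF, Function.comp_apply, fanoutFn_apply, tgt1F_encode φ, tgt2F_encode φ h3, addFn_boolPair, bitsToNat_encodeNat,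
    bitsToNat_encodeNat, target]

/-- **Value of the transformation on a three-literal CNF code**: the KNAPSACK code of
`(numbers φ, target φ)`. [cite: Sipser2012, Thm 7.56] -/
theorem outKF_encode : outKF (encodingCNF.encode φ) = Knapsack.encodingK.encode (numbers φ, target φ) := by
  rw [outKF, fanoutFn_apply, fanoutFn_apply, numbersF_encode φ h3, targetF_encode φ h3, NU_encode, Com.ones_append, encode_K_eq]
  congr 2
  rw [numbers, List.length_map, List.length_range, two_mul]

end listValues

/-! ### The guarded reduction and `ONEIN3SAT ≤ₚ KNAPSACK` -/

/-- **The Karp reduction `ONEIN3SAT → KNAPSACK` on codes**: the transformation on canonical codes of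
clause lists with three pairwise distinct literals per clause (`OneInThree.goodF`), Knapsack's fixed
non-member `badK` on every other string. [cite: Sipser2012, Thm 7.56] [cite: GareyJohnson1979, LO4] -/
def redKF : List Bool → List Bool := iteFn goodF outKF (fun _ => badK)

/-- **`redKF ∈ FP`.** [cite: Sipser2012, Thm 7.56 ("in polynomial time")] [cite: AroraBarak2009, §1.3] -/
theorem redKF_mem_FP : redKF ∈ FP := iteFn_mem_FP goodF_mem_FP outKF_mem_FP (const_mem_FP _)

/-- Value of `redKF` on a CNF code. [folklore] -/
theorem redKF_encode (φ : CNF ℕ) :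
    redKF (encodingCNF.encode φ) =
      if φ.IsThreeLiteralClauses then Knapsack.encodingK.encode (numbers φ, target φ) else badK := by
  rw [redKF, iteFn_apply (goodF_encode φ)]
  by_cases h : φ.IsThreeLiteralClauses
  · rw [decide_eq_true h, if_pos rfl, if_pos h, outKF_encode φ (fun c hc => (h c hc).1)]
  · rw [decide_eq_false h, if_neg Bool.false_ne_true, if_neg h]

/-- Value of `redKF` on a non-code. [folklore] -/
theorem redKF_of_not_canon {x : List Bool} (hx : encodingCNF.encode (NegCNF.decCNF x) ≠ x) : redKF x = badK := by
  rw [redKF, iteFn_apply (goodF_of_not_canon hx), if_neg Bool.false_ne_true]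

/-- **`ONE-IN-THREE 3SAT ≤ₚ KNAPSACK`** (the one-in-three, occurrence-indexed form of Sipser's
`3SAT ≤ₚ SUBSET-SUM`). [cite: Sipser2012, Thm 7.56] [cite: Karp1972, §4 (problem 18)] -/
theorem ONEIN3SAT_karpReducible_KNAPSACK : ONEIN3SAT ≤ₚ KNAPSACK := by
  refine ⟨redKF, redKF_mem_FP, fun x => ?_⟩
  show x ∈ ONEIN3SAT ↔ redKF x ∈ Knapsack.encodingK.toLanguage knapsackSet
  by_cases hx : encodingCNF.encode (NegCNF.decCNF x) = x
  · rw [← hx, redKF_encode, mem_ONEIN3SAT_iff]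
    by_cases h : (NegCNF.decCNF x).IsThreeLiteralClauses
    · rw [if_pos h, Knapsack.encodingK.mem_toLanguage_iff, knapsack_iff _ (fun c hc => (h c hc).1)]
      exact ⟨fun h' => h'.2, fun h' => ⟨h, h'⟩⟩
    · rw [if_neg h]
      exact ⟨fun h' => (h h'.1).elim, fun h' => (badK_not_mem_KNAPSACK h').elim⟩
  · rw [redKF_of_not_canon hx]
    exact ⟨fun h => (hx (KSATRed.encode_decCNF_of_mem h)).elim, fun h => (badK_not_mem_KNAPSACK h).elim⟩

end OneInThreeSS

/-! ### Discharges: KNAPSACK and PARTITION are NP-complete -/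

/-- **KNAPSACK (SUBSET SUM) is NP-hard**: ONE-IN-THREE 3SAT is NP-hard
(`Schaefer1978_oneInThreeSAT_NPHard_holds`: Cook–Levin, `SAT ≤ₚ 3SAT ≤ₚ ONEIN3SAT`, all in the tree) and
`ONEIN3SAT ≤ₚ KNAPSACK`. [cite: Karp1972, §4 (Main Theorem, problem 18)] [cite: Sipser2012, Thm 7.56] -/
theorem KNAPSACK_isNPHard : IsNPHard KNAPSACK :=
  IsHard.of_reducible_holds Schaefer1978_oneInThreeSAT_NPHard_holds OneInThreeSS.ONEIN3SAT_karpReducible_KNAPSACK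

/-- **Discharge of `isNPComplete_KNAPSACK`** (`KarpProblems.lean`; Karp 1972, problem 18): KNAPSACK is
NP-complete — in `NP` by `Knapsack.KNAPSACK_mem_NP`, NP-hard by `KNAPSACK_isNPHard`.
[cite: Karp1972, §4 (Main Theorem, problem 18)] [cite: Sipser2012, Thm 7.56] -/
theorem isNPComplete_KNAPSACK_holds : isNPComplete_KNAPSACK := ⟨Knapsack.KNAPSACK_mem_NP, KNAPSACK_isNPHard⟩

/-- **Discharge of `isNPComplete_PARTITION`** (`KarpProblems.lean`; Karp 1972, problem 20): PARTITION is
NP-complete — Karp's `KNAPSACK ∝ PARTITION` (`Knapsack.KNAPSACK_karpReducible_PARTITION`) from the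
NP-complete KNAPSACK, membership by `Knapsack.PARTITION_mem_NP`.
[cite: Karp1972, §4 (Main Theorem, problem 20; KNAPSACK ∝ PARTITION)] [cite: GareyJohnson1979, Thm 3.5] -/
theorem isNPComplete_PARTITION_holds : isNPComplete_PARTITION :=
  IsComplete.of_reducible_holds isNPComplete_KNAPSACK_holds Knapsack.KNAPSACK_karpReducible_PARTITION
    Knapsack.PARTITION_mem_NP

end Literature.Computability.Complexity

end
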